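import Summits.AtomisticToContinuum.FouriersLaw.Theses.CoercivePulse
import Summits.AtomisticToContinuum.FouriersLaw.Theorems.HoelderEscapeProfileAbelSpreadCeilingFixedTimeRegularity
import Literature.MathematicalPhysics.KineticTheory.InfiniteChainGibbsExistenceShift
import Literature.MathematicalPhysics.KineticTheory.InfiniteChainSuperstableReversal
import Literature.MathematicalPhysics.KineticTheory.InfiniteChainGibbsInvariance
import Literature.MathematicalPhysics.KineticTheory.InfiniteChainShiftInvariantUniqueness
import Literature.MathematicalPhysics.KineticTheory.InfiniteChainAbelWitness
import HarnessLib

/-!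
# `LinearSpread` / Negative (2): the two junk-excluding hypotheses are load-bearing

Support file (`--supports stmt-AtomisticToContinuum-15382`) of the crux DISPROVER of
`Summit.AtomisticToContinuum.FouriersLaw.Theses.CoercivePulse.LinearSpread` (diffusive lower envelope of the
Helfand moment `M(t) = Σ_x x² Cov(h_0, h_x∘φ_t)` of the infinite pinned quartic chain: `m·t ≤ M(t)` eventually,
`m > 0`).  The crux is NOT refuted (it is the positivity half of Fourier's law for the clean chain, open); the
companion file `JunkDynamicsExcluded.lean` (vetting seat) shows that frozen flows are EXCLUDED by the guard.  This
file lands the complementary `_false_without_` theorems — what breaks when each junk-excluding hypothesis is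
deleted — with the weakened statements spelled INLINE (no new `Prop` definitions):

* `linearSpread_false_without_gibbs` — the crux with "DLR Gibbs state at `T`" weakened to "probability measure"
  is FALSE: the Dirac mass at rest with the REST dynamics of `InfiniteChainAbelWitness` §3 (carrier `{rest}`,
  identity flow — a legitimate `InfiniteChainDynamics` since `U'(0) = 0`) is shift-, reversal- and flow-invariant,
  its pulse is `S ≡ 0`, the guard holds and `M ≡ 0` (the same witness refutes `UnboundedHeatVariance` without
  Gibbs, `Theorems/UnboundedHeatVariance/Negative/LoadBearing.lean`; here it is run on the energy pulse).
* `linearSpread_false_without_carrierAE` — the crux with `D.PreservesMeasure μ` weakened to its second clause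
  "every `φ_t` preserves `μ`" is FALSE: in the GENUINE shift-invariant superstable DLR state at
  `ω₂ = lam = β = T = 1`, `γ = 0` (reversal invariant by uniqueness), the IDLE dynamics (empty carrier, `φ_t = id`)
  preserves `μ`, commutes with the shift, its pulse is the static covariance at every time (guard = the landed
  static-pulse summability `summable_one_add_sq_mul_abs_staticPulse`), and `M(t) = M(0)` is constant.

Moral for provers: (i) DLR must be used through a NON-DEGENERACY consequence (frozen states have `χ = 0`);
(ii) the clause `∀ᵐ σ ∂μ, σ ∈ D.carrier` (a.e. orbit solves Newton's equations) must be used — measure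
preservation plus all symmetries of the crux do not move energy.  refuter-cdisprove-stmt-AtomisticToContinuum-15382-0,
2026-08-17.
-/

noncomputable section

namespace Summit.AtomisticToContinuum.FouriersLaw.Theorems.LinearSpread.Negative

open MeasureTheory Filter Set Function
open scoped Topology BigOperators
open Literature.MathematicalPhysics.KineticTheory.HeatConduction

/-! ## §1 Without the Gibbs hypothesis: the rest state -/

/-- **`LinearSpread` without the Gibbs hypothesis is false.**  Replace `IsChainGibbsMeasure T μ` by
`IsProbabilityMeasure μ` (everything else verbatim): at `ω₂ = lam = β = T = 1`, `γ = 0`, the Dirac mass at the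
rest configuration and the rest dynamics `OscillatorChain.restDynamics` (carrier `{restConfig}`, `φ_t = id`; `InfiniteChainAbelWitness` §3) satisfy every remaining hypothesis with pulse
`S ≡ 0`, so `M ≡ 0` and no `m > 0` has `m·t ≤ M(t)` for large `t`. [folklore] -/
theorem linearSpread_false_without_gibbs :
    ¬ (∀ ω₂ lam β γ : ℝ, 0 < ω₂ → 0 < lam → 0 < β → ∀ T : ℝ, 0 < T →
      ∀ μ : Measure ChainConfig, IsProbabilityMeasure μ → IsShiftInvariant μ →
      μ.map (fun σ : ChainConfig => fun x : ℤ => ((σ x).1, -(σ x).2)) = μ →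
      ∀ D : InfiniteChainDynamics (pinnedChain ω₂ lam β γ), D.PreservesMeasure μ →
      (∀ t : ℝ, ∀ᵐ σ ∂μ, D.flow t (shift σ) = shift (D.flow t σ)) →
      ∀ h : ChainConfig → ℤ → ℝ, h = (fun (σ : ChainConfig) (x : ℤ) => (σ x).2 ^ 2 / 2 +
        (pinnedChain ω₂ lam β γ).U (σ x).1 + ((pinnedChain ω₂ lam β γ).V ((σ (x + 1)).1 - (σ x).1) +
        (pinnedChain ω₂ lam β γ).V ((σ x).1 - (σ (x - 1)).1)) / 2) →
      ∀ S : ℤ → ℝ → ℝ, S = (fun (x : ℤ) (t : ℝ) => ∫ σ, (h σ 0 - ∫ σ', h σ' 0 ∂μ) *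
        (h (D.flow t σ) x - ∫ σ', h σ' 0 ∂μ) ∂μ) →
      (∀ t : ℝ, Summable (fun x : ℤ => (1 + (x : ℝ) ^ 2) * |S x t|)) →
      ∃ m t₂ : ℝ, 0 < m ∧ ∀ t : ℝ, t₂ ≤ t → m * t ≤ ∑' x : ℤ, (x : ℝ) ^ 2 * S x t) := by
  intro H
  set P : OscillatorChain := pinnedChain 1 1 1 0 with hP
  have hU : deriv P.U 0 = 0 := deriv_U_pinnedChain_zero 1 1 1 0
  -- the rest configuration and the rest dynamics (carrier `{restConfig}`, identity flow; in tree)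
  set D : InfiniteChainDynamics P := P.restDynamics hU with hD
  set μ₀ : Measure ChainConfig := Measure.dirac restConfig with hμ₀
  haveI : IsProbabilityMeasure μ₀ := by rw [hμ₀]; infer_instance
  have hSI : IsShiftInvariant μ₀ := by
    rw [hμ₀]
    unfold IsShiftInvariant
    rw [Measure.map_dirac]
    rfl
  have hRev : μ₀.map (fun σ : ChainConfig => fun x : ℤ => ((σ x).1, -(σ x).2)) = μ₀ := by
    rw [hμ₀, Measure.map_dirac]
    congr 1
    funext x
    simp [restConfig]
  have hPres : D.PreservesMeasure μ₀ := by
    rw [hD, hμ₀]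
    exact P.restDynamics_preserves_dirac hU
  have hcov : ∀ t : ℝ, ∀ᵐ σ ∂μ₀, D.flow t (shift σ) = shift (D.flow t σ) :=
    fun t => Eventually.of_forall fun σ => rfl
  obtain ⟨hE, hhE⟩ : ∃ hE : ChainConfig → ℤ → ℝ, hE = (fun (σ : ChainConfig) (x : ℤ) =>
      (σ x).2 ^ 2 / 2 + P.U (σ x).1 + (P.V ((σ (x + 1)).1 - (σ x).1) +
        P.V ((σ x).1 - (σ (x - 1)).1)) / 2) := ⟨_, rfl⟩
  obtain ⟨SE, hSE⟩ : ∃ SE : ℤ → ℝ → ℝ, SE = (fun (x : ℤ) (t : ℝ) =>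
      ∫ σ, (hE σ 0 - ∫ σ', hE σ' 0 ∂μ₀) * (hE (D.flow t σ) x - ∫ σ', hE σ' 0 ∂μ₀) ∂μ₀) := ⟨_, rfl⟩
  -- the pulse of the rest state vanishes identically
  have hS0 : ∀ (x : ℤ) (t : ℝ), SE x t = 0 := by
    intro x t
    rw [hSE]
    beta_reduce
    rw [hμ₀]
    simp only [integral_dirac]
    ring
  have hsum : ∀ t : ℝ, Summable (fun x : ℤ => (1 + (x : ℝ) ^ 2) * |SE x t|) := fun t => by
    simp only [hS0, abs_zero, mul_zero]
    exact summable_zero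
  obtain ⟨m, t₂, hm, hmt⟩ := H 1 1 1 0 one_pos one_pos one_pos 1 one_pos μ₀ inferInstance hSI hRev D
    hPres hcov hE hhE SE hSE hsum
  have h1 := hmt (max t₂ 1) (le_max_left _ _)
  simp only [hS0, mul_zero, tsum_zero] at h1
  have : 0 < m * max t₂ 1 := mul_pos hm (lt_of_lt_of_le one_pos (le_max_right _ _))
  linarith

/-! ## §2 Without the a.e.-carrier clause: the idle dynamics in the genuine Gibbs state -/

/-- **`LinearSpread` without the a.e.-carrier clause is false.**  Replace `D.PreservesMeasure μ` by its second
clause `∀ t, MeasurePreserving (D.flow t) μ μ` (so nothing ties `D.flow` to Newton's equations): at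
`ω₂ = lam = β = T = 1`, `γ = 0`, for the shift-invariant superstable DLR state `μ` of the tree (reversal invariant
by uniqueness in its class) and the IDLE dynamics `⟨∅, φ_t = id, …⟩`, every remaining hypothesis holds — the pulse
is the static covariance `s(x) = Cov_μ(h_0,h_x)` at every `t`, and the guard is the landed static-pulse summability
imported through the Buttà–Marchioro dynamics (`φ_0 = id` a.e.) — while `M(t) = Σ x² s(x)` is constant, so the
conclusion fails at `t = max t₂ (M(0)/m + 1)`.  Any proof of the crux must USE `∀ᵐ σ ∂μ, σ ∈ D.carrier`. [folklore] -/
theorem linearSpread_false_without_carrierAE :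
    ¬ (∀ ω₂ lam β γ : ℝ, 0 < ω₂ → 0 < lam → 0 < β → ∀ T : ℝ, 0 < T →
      ∀ μ : Measure ChainConfig, (pinnedChain ω₂ lam β γ).IsChainGibbsMeasure T μ → IsShiftInvariant μ →
      μ.map (fun σ : ChainConfig => fun x : ℤ => ((σ x).1, -(σ x).2)) = μ →
      ∀ D : InfiniteChainDynamics (pinnedChain ω₂ lam β γ), (∀ t : ℝ, MeasurePreserving (D.flow t) μ μ) →
      (∀ t : ℝ, ∀ᵐ σ ∂μ, D.flow t (shift σ) = shift (D.flow t σ)) →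
      ∀ h : ChainConfig → ℤ → ℝ, h = (fun (σ : ChainConfig) (x : ℤ) => (σ x).2 ^ 2 / 2 +
        (pinnedChain ω₂ lam β γ).U (σ x).1 + ((pinnedChain ω₂ lam β γ).V ((σ (x + 1)).1 - (σ x).1) +
        (pinnedChain ω₂ lam β γ).V ((σ x).1 - (σ (x - 1)).1)) / 2) →
      ∀ S : ℤ → ℝ → ℝ, S = (fun (x : ℤ) (t : ℝ) => ∫ σ, (h σ 0 - ∫ σ', h σ' 0 ∂μ) *
        (h (D.flow t σ) x - ∫ σ', h σ' 0 ∂μ) ∂μ) →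
      (∀ t : ℝ, Summable (fun x : ℤ => (1 + (x : ℝ) ^ 2) * |S x t|)) →
      ∃ m t₂ : ℝ, 0 < m ∧ ∀ t : ℝ, t₂ ≤ t → m * t ≤ ∑' x : ℤ, (x : ℝ) ^ 2 * S x t) := by
  intro H
  set P : OscillatorChain := pinnedChain 1 1 1 0 with hP
  obtain ⟨μ, hG, hS, hss⟩ :=
    OscillatorChain.exists_isChainGibbsMeasure_shiftInvariant_superstable_pinnedChain (0:ℝ) one_pos
      zero_le_one zero_le_one one_pos (ω₂ := 1) (lam := 1) (β := 1) (T := 1)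
  haveI : IsProbabilityMeasure μ := hG.isProbabilityMeasure
  -- reversal invariance from uniqueness of the shift-invariant DLR state
  have huniq : ∀ μ₁ μ₂ : Measure ChainConfig,
      P.IsChainGibbsMeasure 1 μ₁ → IsShiftInvariant μ₁ → P.HasSuperstabilityEstimate μ₁ →
      P.IsChainGibbsMeasure 1 μ₂ → IsShiftInvariant μ₂ → P.HasSuperstabilityEstimate μ₂ → μ₁ = μ₂ :=
    fun μ₁ μ₂ h₁ s₁ _ h₂ s₂ _ =>
      OscillatorChain.eq_of_isChainGibbsMeasure_of_isShiftInvariant_pinnedChain 0 one_pos zero_le_one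
        zero_le_one one_pos h₁ s₁ h₂ s₂
  have hR : μ.map momentumReversalZ = μ :=
    OscillatorChain.map_momentumReversalZ_eq_of_regular_unique hG hS hss huniq
  have hR' : μ.map (fun σ : ChainConfig => fun x : ℤ => ((σ x).1, -(σ x).2)) = μ := hR
  -- the genuine (Buttà–Marchioro) dynamics, used only to import the static guard
  have hU1 : OscillatorChain.IsEvenPolyOfDegree P.U 2 :=
    OscillatorChain.pinnedChain_isEvenPolyOfDegree_U (1:ℝ) (0:ℝ) zero_le_one one_pos
  have hV1 : OscillatorChain.IsEvenPolyOfDegree P.V 2 :=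
    OscillatorChain.pinnedChain_isEvenPolyOfDegree_V (1:ℝ) (1:ℝ) (0:ℝ) one_pos
  obtain ⟨D₀, -, -, -, -, -, -, hpres⟩ :=
    OscillatorChain.exists_bmDynamics (by norm_num) (by norm_num) hU1 hV1
  have hD₀ : D₀.PreservesMeasure μ := hpres 1 μ hG hss
  -- the idle dynamics and the crux's data
  set D : InfiniteChainDynamics P :=
    ⟨∅, fun _ σ => σ, fun _ => mapsTo_empty _ _, fun _ h => (notMem_empty _ h).elim,
      fun _ h => (notMem_empty _ h).elim, fun _ hγ _ _ => (notMem_empty _ (hγ 0)).elim⟩ with hD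
  have hmp : ∀ t : ℝ, MeasurePreserving (D.flow t) μ μ := fun _ => MeasurePreserving.id μ
  have hcov : ∀ t : ℝ, ∀ᵐ σ ∂μ, D.flow t (shift σ) = shift (D.flow t σ) :=
    fun _ => Eventually.of_forall fun _ => rfl
  obtain ⟨hE, hhE⟩ : ∃ hE : ChainConfig → ℤ → ℝ, hE = (fun (σ : ChainConfig) (x : ℤ) =>
      (σ x).2 ^ 2 / 2 + P.U (σ x).1 + (P.V ((σ (x + 1)).1 - (σ x).1) +
        P.V ((σ x).1 - (σ (x - 1)).1)) / 2) := ⟨_, rfl⟩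
  have hhE' : hE = fun σ x => P.energyDensityZ σ x := hhE
  obtain ⟨s, hs⟩ : ∃ s : ℤ → ℝ, s = (fun x : ℤ =>
      ∫ σ, (hE σ 0 - ∫ σ', hE σ' 0 ∂μ) * (hE σ x - ∫ σ', hE σ' 0 ∂μ) ∂μ) := ⟨_, rfl⟩
  have hSdef : (fun (x : ℤ) (_ : ℝ) => s x) = (fun (x : ℤ) (t : ℝ) =>
      ∫ σ, (hE σ 0 - ∫ σ', hE σ' 0 ∂μ) * (hE (D.flow t σ) x - ∫ σ', hE σ' 0 ∂μ) ∂μ) := by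
    rw [hs]
  -- the guard: static-pulse summability, landed (via `D₀`, whose `φ_0 = id` a.e.)
  have hsum : Summable fun x : ℤ => (1 + (x : ℝ) ^ 2) * |s x| := by
    have h0 := Summit.AtomisticToContinuum.FouriersLaw.Theorems.AbelSpreadCeiling.RegularityCollapse.summable_one_add_sq_mul_abs_staticPulse
      one_pos one_pos one_pos one_pos hG hS D₀ hD₀ hhE'
    refine h0.congr fun x => ?_
    rw [hs]
    congr 2
    refine integral_congr_ae ?_
    filter_upwards [D₀.flow_zero_ae_eq hD₀] with σ hσ
    rw [hσ]
  obtain ⟨m, t₂, hm, hmt⟩ := H 1 1 1 0 one_pos one_pos one_pos 1 one_pos μ hG hS hR' D hmp hcov hE hhE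
    (fun x _ => s x) hSdef (fun _ => hsum)
  set M₀ : ℝ := ∑' x : ℤ, (x : ℝ) ^ 2 * s x with hM₀
  have h1 := hmt (max t₂ (M₀ / m + 1)) (le_max_left _ _)
  have h2 : m * (M₀ / m + 1) ≤ m * max t₂ (M₀ / m + 1) :=
    mul_le_mul_of_nonneg_left (le_max_right _ _) hm.le
  have h3 : m * (M₀ / m + 1) = M₀ + m := by field_simp
  linarith

end Summit.AtomisticToContinuum.FouriersLaw.Theorems.LinearSpread.Negative

end
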